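import Summits.QuantumFields.BalabanUV.T4Continuum.Support.CovariantVectorChartModulus
import Summits.QuantumFields.BalabanUV.T4Continuum.Support.CTWeightedEnergy

/-!
# T⁴ programme, SUBSTRATE (shared lattice-gauge analysis library) — THE EXACT FACTORISATION OF THE TWO-SIDED COVARIANT LAPLACIAN ALONG THE
# EXPONENTIAL CHART and the per-direction FORM bound (tools for the form-relative holomorphy radius, file `CovariantVectorCoerciveHoloForm`)

Substrate cell `b2b-balaban-substrate-*`, seat p3 (NE9 owner's request Q-S15, journal l.15770; typer NEXT gen 6 item 1(c)).  With `M_ν = siteMul (e^{A_ν})`,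
`N_ν = siteMul (e^{−A_ν})` ([folklore] algebra on p1's two-sided species of `SubstrateTransporterSpecies`):
 * §1 **exact identities**: `siteMul_expChart` ∕ `siteMul_expChartInv`, `Nfac_mul_Mfac` (`N_ν·M_ν = 1`), **`covDc_expChart_eq`**
   (`∇(e^{A}R⁰)_ν = M_ν·∇(R⁰)_ν + c·(M_ν − 1)`), **`covDcA_expChartInv_eq`** (`∇ᴬ((R⁰)⁻¹e^{−A})_ν = ∇ᴬ((R⁰)⁻¹)_ν·N_ν + c̄·(N_ν − 1)`), and
   **`cross_expand`**: `∇ᴬ_ν·∇_ν = Dᴬ·D + c·Dᴬ·N(M − 1) + c̄·(N − 1)M·D + (c̄c)·(N − 1)(M − 1)` — the unperturbed product survives EXACTLY;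
 * §2 **form bounds**: `re_cross_left_le`, `re_cross_right_le`, **`re_term_ge`** (`Re⟨v,(DᴴD + c·DᴴX + c′·YD + Z)v⟩ ≥ ½‖Dv‖² − (K²/2 + z)‖v‖²` for
   `‖c‖‖X‖ + ‖c′‖‖Y‖ ≤ K`, `‖Z‖ ≤ z`); §2b the averaging difference in operator norm: `QcovA_eq_conjTranspose`, `Etr`, **`opNorm_avg_sub_le`**
   (`‖Qᴬ(S)Q(R) − Qᴬ(S′)Q(R′)‖ ≤ n^{−d}·|o|·E·(2(2|o|+1) + |o|·E)`, `E = (1+δ)^ℓ − 1`).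

HONEST FRAMING (T4-DAG p. 1).  Finite-dimensional linear algebra ([folklore]); no estimate of any NE row; nothing printed is a hypothesis; no
`def … : Prop`; spine 0/9 unchanged; NOT infinite volume ∕ mass gap ∕ Clay.  HONEST DEPENDENCY: continuum YM on T⁴ ⇐ BetaPertH ∧ nine spine estimates
(0/9 proved); BetaPertH ⇐ (D1) ∧ (D4) ∧ CAP+tail; G-an2-4 gates asym, D1 and NE2/3/4.  ABSOLUTE RULE kept; no `sorry`.
-/

noncomputable section

open scoped BigOperators ComplexConjugate Matrix Matrix.Norms.L2Operator Kronecker ComplexOrder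

namespace Summit.QuantumFields.BalabanUV.T4Continuum.CovariantVectorChartFactorisation

open Literature.MathematicalPhysics.QuantumFieldTheory.Balaban1983to89.B5Prop11Plancherel (Tor fine shiftM)
open Literature.MathematicalPhysics.QuantumFieldTheory.Balaban1983to89.B5Prop11Lower (nsq nsq_nonneg norm_star_dotProduct_le star_dotProduct_self)
open Literature.MathematicalPhysics.QuantumFieldTheory.Balaban1983to89.B5Action121 (star_mulVec_dotProduct)
open Summit.QuantumFields.BalabanUV.T4Continuum
open Summit.QuantumFields.BalabanUV.T4Continuum.BlockMultiplication (siteMul siteMul_sub siteMul_one siteMul_mul opNorm_siteMul_le)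
open Summit.QuantumFields.BalabanUV.T4Continuum.ColourCovariantLaplacian (covDc covLapC)
open Summit.QuantumFields.BalabanUV.T4Continuum.CovariantBlockAveraging (transport ContourSystem Qcov)
open Summit.QuantumFields.BalabanUV.T4Continuum.CoerciveInverseTower (Coercive isUnit_of_coercive opNorm_inv_le_of_coercive)
open Summit.QuantumFields.BalabanUV.T4Continuum.GaugeTermResolventBounds (re_form_gram)
open Summit.QuantumFields.BalabanUV.T4Continuum.GaugeTermCoercivity (abs_re_form_le)
open Summit.QuantumFields.BalabanUV.T4Continuum.CTWeightedEnergy (sqrt_nsq_mulVec_le)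
open Summit.QuantumFields.BalabanUV.T4Continuum.SubstrateTransporterSpecies
open Summit.QuantumFields.BalabanUV.T4Continuum.CovariantVectorCoercive (vecOp covLapC_eq_gram nsq_stackM_mulVec stackM)
open Summit.QuantumFields.BalabanUV.T4Continuum.CovariantVectorCoerciveHolo
open Summit.QuantumFields.BalabanUV.T4Continuum.CovariantVectorChartModulus

variable {d : ℕ} {o : Type*} [Fintype o] [DecidableEq o] [Nonempty o]

/-! ## §1 The exact factorisation along the chart -/

section Algebra

variable (Nf : Fin d → ℕ) [hNf : ∀ μ, NeZero (Nf μ)]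
variable (R₀ A : Fin d → (Tor Nf × Fin d → Matrix o o ℂ)) (ν : Fin d)

/-- `M_ν = siteMul (e^{A ν ·})`. [folklore] -/
def Mfac : Matrix ((Tor Nf × Fin d) × o) ((Tor Nf × Fin d) × o) ℂ := siteMul fun i => NormedSpace.exp (A ν i)

/-- `N_ν = siteMul (e^{−A ν ·})`. [folklore] -/
def Nfac : Matrix ((Tor Nf × Fin d) × o) ((Tor Nf × Fin d) × o) ℂ := siteMul fun i => NormedSpace.exp (-(A ν i))

omit [Nonempty o] in
/-- `siteMul (e^{A}R⁰)_ν = M_ν · siteMul (R⁰_ν)`. [folklore] -/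
theorem siteMul_expChart : siteMul (expChart R₀ A ν) = Mfac Nf A ν * siteMul (R₀ ν) := by
  rw [Mfac, siteMul_mul]; rfl

omit [Nonempty o] in
/-- `siteMul ((R⁰)⁻¹e^{−A})_ν = siteMul ((R⁰_ν)⁻¹) · N_ν`. [folklore] -/
theorem siteMul_expChartInv : siteMul (expChartInv R₀ A ν) = siteMul (fun i => (R₀ ν i)⁻¹) * Nfac Nf A ν := by
  rw [Nfac, siteMul_mul]; rfl

omit [Nonempty o] in
/-- **`N_ν · M_ν = 1`** (`e^{−X}e^{X} = 1`). [folklore] -/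
theorem Nfac_mul_Mfac : Nfac Nf A ν * Mfac Nf A ν = 1 := by
  rw [Nfac, Mfac, siteMul_mul, ← siteMul_one]
  congr 1; funext i; exact exp_neg_mul_exp (A ν i)

omit [Nonempty o] in
/-- **`∇(e^{A}R⁰)_ν = M_ν·∇(R⁰)_ν + c·(M_ν − 1)`**. [folklore] -/
theorem covDc_expChart_eq (c : ℂ) :
    covDc Nf c (expChart R₀ A) ν = Mfac Nf A ν * covDc Nf c R₀ ν + c • (Mfac Nf A ν - 1) := by
  rw [covDc, covDc, siteMul_expChart, Matrix.mul_smul, ← smul_add]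
  congr 1
  rw [Matrix.mul_sub, Matrix.mul_one, Matrix.mul_assoc]
  abel

omit [Nonempty o] in
/-- **`∇ᴬ((R⁰)⁻¹e^{−A})_ν = ∇ᴬ((R⁰)⁻¹)_ν·N_ν + c̄·(N_ν − 1)`**. [folklore] -/
theorem covDcA_expChartInv_eq (c : ℂ) :
    covDcA Nf c (expChartInv R₀ A) ν = covDcA Nf c (fun μ i => (R₀ μ i)⁻¹) ν * Nfac Nf A ν + (starRingEnd ℂ) c • (Nfac Nf A ν - 1) := by
  rw [covDcA, covDcA, siteMul_expChartInv, Matrix.smul_mul, ← smul_add]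
  congr 1
  rw [Matrix.sub_mul, Matrix.one_mul, Matrix.mul_assoc]
  abel

omit [Nonempty o] in
/-- **THE EXACT EXPANSION** `∇ᴬ_ν∇_ν = DᴬD + c·DᴬN(M − 1) + c̄·(N − 1)MD + (c̄c)·(N − 1)(M − 1)` (`Dᴬ N M D = Dᴬ D` by `NM = 1`). [folklore] -/
theorem cross_expand (c : ℂ) :
    covDcA Nf c (expChartInv R₀ A) ν * covDc Nf c (expChart R₀ A) ν
      = covDcA Nf c (fun μ i => (R₀ μ i)⁻¹) ν * covDc Nf c R₀ ν
        + c • (covDcA Nf c (fun μ i => (R₀ μ i)⁻¹) ν * (Nfac Nf A ν * (Mfac Nf A ν - 1)))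
        + (starRingEnd ℂ) c • ((Nfac Nf A ν - 1) * Mfac Nf A ν * covDc Nf c R₀ ν)
        + ((starRingEnd ℂ) c * c) • ((Nfac Nf A ν - 1) * (Mfac Nf A ν - 1)) := by
  set D := covDc Nf c R₀ ν
  set Da := covDcA Nf c (fun μ i => (R₀ μ i)⁻¹) ν
  set Mm := Mfac Nf A ν
  set Nn := Nfac Nf A ν
  have hNM : Nn * Mm = 1 := Nfac_mul_Mfac Nf A ν
  rw [covDcA_expChartInv_eq, covDc_expChart_eq]
  have e1 : Da * Nn * (Mm * D) = Da * D := by rw [Matrix.mul_assoc, ← Matrix.mul_assoc Nn, hNM, Matrix.one_mul]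
  have e2 : Da * Nn * (c • (Mm - 1)) = c • (Da * (Nn * (Mm - 1))) := by rw [Matrix.mul_smul, Matrix.mul_assoc]
  have e3 : ((starRingEnd ℂ) c • (Nn - 1)) * (Mm * D) = (starRingEnd ℂ) c • ((Nn - 1) * Mm * D) := by rw [Matrix.smul_mul, Matrix.mul_assoc]
  have e4 : ((starRingEnd ℂ) c • (Nn - 1)) * (c • (Mm - 1)) = ((starRingEnd ℂ) c * c) • ((Nn - 1) * (Mm - 1)) := by
    rw [Matrix.smul_mul, Matrix.mul_smul, smul_smul]
  rw [Matrix.add_mul, Matrix.mul_add, Matrix.mul_add, e1, e2, e3, e4]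
  abel

end Algebra

/-! ## §2 The form bounds -/

section Forms

variable {σ : Type*} [Fintype σ] [DecidableEq σ]

omit [Fintype o] [DecidableEq o] [Nonempty o] in
/-- left cross term: `|Re⟨v, c·DᴴXv⟩| ≤ ‖c‖·‖X‖·√nsq(Dv)·√nsq v`. [folklore] -/
theorem re_cross_left_le (D X : Matrix σ σ ℂ) (c : ℂ) (v : σ → ℂ) :
    |(star v ⬝ᵥ ((c • (Dᴴ * X)) *ᵥ v)).re| ≤ ‖c‖ * ‖X‖ * (Real.sqrt (nsq (D *ᵥ v)) * Real.sqrt (nsq v)) := by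
  rw [Matrix.smul_mulVec, dotProduct_smul, ← Matrix.mulVec_mulVec, ← star_mulVec_dotProduct, smul_eq_mul]
  refine (Complex.abs_re_le_norm _).trans ?_
  rw [norm_mul]
  calc ‖c‖ * ‖star (D *ᵥ v) ⬝ᵥ (X *ᵥ v)‖ ≤ ‖c‖ * (Real.sqrt (nsq (D *ᵥ v)) * (‖X‖ * Real.sqrt (nsq v))) :=
        mul_le_mul_of_nonneg_left ((norm_star_dotProduct_le _ _).trans (mul_le_mul_of_nonneg_left (sqrt_nsq_mulVec_le X v) (Real.sqrt_nonneg _)))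
          (norm_nonneg c)
    _ = ‖c‖ * ‖X‖ * (Real.sqrt (nsq (D *ᵥ v)) * Real.sqrt (nsq v)) := by ring

omit [Fintype o] [DecidableEq o] [Nonempty o] in
/-- right cross term: `|Re⟨v, c·YDv⟩| ≤ ‖c‖·‖Y‖·√nsq(Dv)·√nsq v`. [folklore] -/
theorem re_cross_right_le (Y D : Matrix σ σ ℂ) (c : ℂ) (v : σ → ℂ) :
    |(star v ⬝ᵥ ((c • (Y * D)) *ᵥ v)).re| ≤ ‖c‖ * ‖Y‖ * (Real.sqrt (nsq (D *ᵥ v)) * Real.sqrt (nsq v)) := by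
  rw [Matrix.smul_mulVec, dotProduct_smul, ← Matrix.mulVec_mulVec, smul_eq_mul]
  refine (Complex.abs_re_le_norm _).trans ?_
  rw [norm_mul]
  calc ‖c‖ * ‖star v ⬝ᵥ (Y *ᵥ (D *ᵥ v))‖ ≤ ‖c‖ * (Real.sqrt (nsq v) * (‖Y‖ * Real.sqrt (nsq (D *ᵥ v)))) :=
        mul_le_mul_of_nonneg_left ((norm_star_dotProduct_le _ _).trans (mul_le_mul_of_nonneg_left (sqrt_nsq_mulVec_le Y _) (Real.sqrt_nonneg _)))
          (norm_nonneg c)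
    _ = ‖c‖ * ‖Y‖ * (Real.sqrt (nsq (D *ᵥ v)) * Real.sqrt (nsq v)) := by ring

omit [Fintype o] [DecidableEq o] [Nonempty o] in
/-- **PER-DIRECTION FORM BOUND**: for `T = DᴴD + c·DᴴX + c′·YD + Z` with `‖c‖‖X‖ + ‖c′‖‖Y‖ ≤ K`, `‖Z‖ ≤ z`:
`Re⟨v, Tv⟩ ≥ ½‖Dv‖² − (K²/2 + z)‖v‖²` (Cauchy–Schwarz: `K·p·q ≤ p²/2 + K²q²/2`). [folklore] -/
theorem re_term_ge {D X Y Z : Matrix σ σ ℂ} {c c' : ℂ} {K z : ℝ} (hK : ‖c‖ * ‖X‖ + ‖c'‖ * ‖Y‖ ≤ K) (hz : ‖Z‖ ≤ z) (v : σ → ℂ) :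
    nsq (D *ᵥ v) / 2 - (K ^ 2 / 2 + z) * nsq v ≤ (star v ⬝ᵥ ((Dᴴ * D + c • (Dᴴ * X) + c' • (Y * D) + Z) *ᵥ v)).re := by
  have h0 := re_form_gram D v
  have h1 := re_cross_left_le D X c v
  have h2 := re_cross_right_le Y D c' v
  have h3 : |(star v ⬝ᵥ (Z *ᵥ v)).re| ≤ z * nsq v := (abs_re_form_le Z v).trans (mul_le_mul_of_nonneg_right hz (nsq_nonneg v))
  rw [abs_le] at h1 h2 h3
  simp only [Matrix.add_mulVec, dotProduct_add, Complex.add_re]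
  rw [h0]
  set p := Real.sqrt (nsq (D *ᵥ v)) with hp
  set q := Real.sqrt (nsq v) with hq
  have hp0 : 0 ≤ p := Real.sqrt_nonneg _
  have hq0 : 0 ≤ q := Real.sqrt_nonneg _
  have hpp : p * p = nsq (D *ᵥ v) := Real.mul_self_sqrt (nsq_nonneg _)
  have hqq : q * q = nsq v := Real.mul_self_sqrt (nsq_nonneg _)
  have hK0 : 0 ≤ K := le_trans (by positivity) hK
  -- `(‖c‖‖X‖ + ‖c′‖‖Y‖)·p·q ≤ K·p·q ≤ p²/2 + K²q²/2`
  have hpq : (‖c‖ * ‖X‖ + ‖c'‖ * ‖Y‖) * (p * q) ≤ nsq (D *ᵥ v) / 2 + K ^ 2 / 2 * nsq v := by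
    have h := mul_le_mul_of_nonneg_right hK (mul_nonneg hp0 hq0)
    rw [← hpp, ← hqq]
    nlinarith [sq_nonneg (p - K * q)]
  nlinarith [h1.1, h2.1, h3.1, nsq_nonneg v]

end Forms

/-! ## §2b The averaging difference in operator norm -/

section Averaging

variable (n : ℕ) [NeZero n] (M : Fin d → ℕ) [hM : ∀ μ, NeZero (M μ)]

omit [NeZero n] hM [Nonempty o] in
/-- `QcovA Γ S = (Qcov Γ (adjOf S))ᴴ` for every `S` (`adjOf` is an involution). [folklore] -/
theorem QcovA_eq_conjTranspose (Γ : ContourSystem d n M) (S : Fin d → (Tor (fine n M) × Fin d → Matrix o o ℂ)) :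
    QcovA n M Γ S = (Qcov n M Γ (adjOf S))ᴴ := by
  rw [← QcovA_adjOf, adjOf_adjOf]

/-- `E(δ, ℓ) = (1 + δ)^ℓ − 1`: the contour-transport modulus. [folklore] -/
abbrev Etr (δ : ℝ) (ℓ : ℕ) : ℝ := (1 + δ) ^ ℓ - 1

omit [Fintype o] [DecidableEq o] [Nonempty o] in
/-- `Etr ≥ 0`. [folklore] -/
theorem Etr_nonneg {δ : ℝ} (hδ : 0 ≤ δ) (ℓ : ℕ) : 0 ≤ Etr δ ℓ := sub_nonneg.mpr (one_le_pow₀ (by linarith))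

/-- **THE AVERAGING-TERM DIFFERENCE** `‖Qᴬ(S)Q(R) − Qᴬ(S′)Q(R′)‖ ≤ n^{−d}·|o|·E·(2(2|o| + 1) + |o|·E)` for references of norm `≤ 1`, bondwise `δ`-close data,
contours of length `≤ ℓ` (`E = Etr δ ℓ`). [folklore] -/
theorem opNorm_avg_sub_le (Γ : ContourSystem d n M) {ℓ : ℕ} (hΓ : ∀ y j μ (t : Fin n), (Γ y j μ t).length ≤ ℓ)
    {R R' S S' : Fin d → (Tor (fine n M) × Fin d → Matrix o o ℂ)} {δ : ℝ} (hδ : 0 ≤ δ)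
    (hR' : ∀ ν i, ‖R' ν i‖ ≤ 1) (hS' : ∀ ν i, ‖S' ν i‖ ≤ 1) (hRR' : ∀ ν i, ‖R ν i - R' ν i‖ ≤ δ) (hSS' : ∀ ν i, ‖S ν i - S' ν i‖ ≤ δ) :
    ‖QcovA n M Γ S * Qcov n M Γ R - QcovA n M Γ S' * Qcov n M Γ R'‖
      ≤ ((n : ℝ) ^ d)⁻¹ * (Fintype.card o * Etr δ ℓ * (2 * (2 * Fintype.card o + 1) + Fintype.card o * Etr δ ℓ)) := by
  have hn : (0 : ℝ) < (n : ℝ) ^ d := pow_pos (by exact_mod_cast Nat.pos_of_ne_zero (NeZero.ne n)) d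
  set s : ℝ := (Real.sqrt ((n : ℝ) ^ d))⁻¹ with hs
  have hss : s * s = ((n : ℝ) ^ d)⁻¹ := by rw [hs, ← mul_inv, Real.mul_self_sqrt hn.le]
  have hE0 : 0 ≤ Etr δ ℓ := Etr_nonneg hδ ℓ
  have hTR : ∀ y j μ (t : Fin n), ‖transport (fine n M) R μ (Γ y j μ t) - transport (fine n M) R' μ (Γ y j μ t)‖ ≤ Etr δ ℓ :=
    fun y j μ t => norm_transport_sub_transport_le (fine n M) hδ hR' hRR' μ (hΓ y j μ t)
  have hS'a : ∀ ν i, ‖adjOf S' ν i‖ ≤ 1 := fun ν i => by rw [adjOf_apply, Matrix.l2_opNorm_conjTranspose]; exact hS' ν i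
  have hSSa : ∀ ν i, ‖adjOf S ν i - adjOf S' ν i‖ ≤ δ := fun ν i => by
    rw [adjOf_apply, adjOf_apply, ← Matrix.conjTranspose_sub, Matrix.l2_opNorm_conjTranspose]; exact hSS' ν i
  have hTS : ∀ y j μ (t : Fin n), ‖transport (fine n M) (adjOf S) μ (Γ y j μ t) - transport (fine n M) (adjOf S') μ (Γ y j μ t)‖ ≤ Etr δ ℓ :=
    fun y j μ t => norm_transport_sub_transport_le (fine n M) hδ hS'a hSSa μ (hΓ y j μ t)
  have h1 : ‖Qcov n M Γ R - Qcov n M Γ R'‖ ≤ Fintype.card o * Etr δ ℓ * s := opNorm_Qcov_sub_Qcov_le n M Γ hE0 hTR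
  have h2 : ‖QcovA n M Γ S - QcovA n M Γ S'‖ ≤ Fintype.card o * Etr δ ℓ * s := by
    rw [QcovA_eq_conjTranspose, QcovA_eq_conjTranspose, ← Matrix.conjTranspose_sub, Matrix.l2_opNorm_conjTranspose]
    exact opNorm_Qcov_sub_Qcov_le n M Γ hE0 hTS
  have h3 : ‖QcovA n M Γ S'‖ ≤ (2 * Fintype.card o + 1) * s := by
    rw [QcovA_eq_conjTranspose, Matrix.l2_opNorm_conjTranspose]; exact opNorm_Qcov_le_of_norm_le_one n M Γ hS'a
  have h4 : ‖Qcov n M Γ R‖ ≤ (2 * Fintype.card o + 1) * s + Fintype.card o * Etr δ ℓ * s :=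
    (norm_le_insert' _ _).trans (add_le_add (opNorm_Qcov_le_of_norm_le_one n M Γ hR') h1)
  rw [show QcovA n M Γ S * Qcov n M Γ R - QcovA n M Γ S' * Qcov n M Γ R'
      = (QcovA n M Γ S - QcovA n M Γ S') * Qcov n M Γ R + QcovA n M Γ S' * (Qcov n M Γ R - Qcov n M Γ R') by
      simp only [Matrix.sub_mul, Matrix.mul_sub]; abel]
  calc _ ≤ ‖(QcovA n M Γ S - QcovA n M Γ S') * Qcov n M Γ R‖ + ‖QcovA n M Γ S' * (Qcov n M Γ R - Qcov n M Γ R')‖ := norm_add_le _ _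
    _ ≤ Fintype.card o * Etr δ ℓ * s * ((2 * Fintype.card o + 1) * s + Fintype.card o * Etr δ ℓ * s)
        + (2 * Fintype.card o + 1) * s * (Fintype.card o * Etr δ ℓ * s) :=
        add_le_add ((Matrix.l2_opNorm_mul _ _).trans (mul_le_mul h2 h4 (norm_nonneg _) (by positivity)))
          ((Matrix.l2_opNorm_mul _ _).trans (mul_le_mul h3 h1 (norm_nonneg _) (by positivity)))
    _ = (s * s) * (Fintype.card o * Etr δ ℓ * (2 * (2 * Fintype.card o + 1) + Fintype.card o * Etr δ ℓ)) := by ring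
    _ = _ := by rw [hss]

end Averaging

end Summit.QuantumFields.BalabanUV.T4Continuum.CovariantVectorChartFactorisation

end
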